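import Literature.NumberTheory.EllipticCurves.HeckeCongruenceModulus
import Literature.NumberTheory.EllipticCurves.ModularCurve
import Mathlib.RingTheory.Ideal.GoingUp
import HarnessLib

/-!
# Pasten's congruence moduli: Prop. 5.4 in polynomial form, minimality of the eigen-ideal and
# positivity of `η_{[χ₀]}([χ])` (proofs)

Topic `NumberTheory/EllipticCurves`; a proofs-only companion (theorems only: no definition, no
named fact, nothing restated; D-0026) of `HeckeCongruenceModulus.lean` and of the named facts of
`PastenSpectralDegree.lean` (Pasten 2024, Thm. 5.5 and the size bound for `η`). Source: H. Pasten,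
*Shimura curves and the abc conjecture*, J. Number Theory 254 (2024) = arXiv:1705.09251
[PastenShimura2024], §4.9–4.11 (p. 16), §5.1 and §5.4 with Prop. 5.4 (p. 17), read.

## Contents (all proved)

* **Prop. 5.4 in polynomial form** over `𝕋 = anemicHeckeRing N k = ℤ[T_p : p ∤ N]`:
  `heckeCongruenceModulus_dvd_aeval` — an integer polynomial relation
  `Q(χ(T_{p₁}), …, χ(T_{p_ℓ})) = 0` among the eigenvalues of a simultaneous eigenvector `g`
  forces `η_{[χ₀]}([χ]) ∣ Q(χ₀(T_{p₁}), …, χ₀(T_{p_ℓ}))`; `anemicHeckeRing.exists_eq_aeval` —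
  every element of `𝕋` is such a polynomial in finitely many generators;
  `dvd_heckeCongruenceModulus_of_forall_aeval` — every `m` with the property divides `η`;
  `isGreatest_heckeCongruenceModulus` — *"`η_{[χ₀]}([χ])` is the largest positive integer `m`
  with the following property …"* (Prop. 5.4 as printed, for `η ≠ 0`). Pasten allows the `T_n`,
  `(n, N) = 1`; since `T_n ∈ ℤ[T_p : p ∣ n]` and `χ`, `χ₀` are ring maps, relations among the
  `χ(T_n)` and among the `χ(T_p)` determine the same largest `m`; primes indexed by `Fin ℓ` here.
* **The eigen-ideal is a minimal prime**: `eigenIdeal_mem_minimalPrimes` — for a nonzero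
  simultaneous eigenvector with integral eigenvalues, `𝕀_{[χ₀]} = ker χ₀` is a minimal prime of
  `𝕋` (a prime `Q ⊆ ker χ₀` has `𝕋 ⧸ Q` an integral domain, module-finite hence integral over `ℤ`,
  in which the image of `ker χ₀` contracts to `0` in `ℤ` and is therefore `0`:
  `Ideal.eq_bot_of_comap_eq_bot`). This is the identification "classes of systems of eigenvalues
  = minimal primes" of Pasten §4.11 for the class `[χ₀]` of the elliptic curve.
* **Positivity of the congruence modulus**: `heckeCongruenceModulus_ne_zero` — for a minimal
  prime `P ≠ 𝕀_{[χ₀]}`, `η = #(𝕋 ⧸ (𝕀_{[χ₀]} + P)) ≠ 0` (Pasten §5.4: "This positive integer"),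
  as `P ⊄ ker χ₀` and `η = [ℤ : χ₀(P)]`.
* **The newform of an elliptic curve**: `ModularParametrizationData.f_ne_zero`,
  `ModularParametrizationData.hasIntegralEigenvalues_f` (`T_p f = a_p(W) f`, `a_p(W) ∈ ℤ`, by
  `a₁(T_p f) = a_p(f)`, Diamond–Shurman Prop. 5.2.2 = the tree's `qExpansion_coeff_heckeT_holds`,
  and `a₁(f) = 1`), and the corollaries `ModularParametrizationData.eigenIdeal_mem_minimalPrimes`,
  `ModularParametrizationData.heckeCongruenceModulus_ne_zero`,
  `ModularParametrizationData.prod_heckeCongruenceModulus_pos` (the product in Pasten's Thm. 5.5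
  is a positive integer).

## References

* H. Pasten, *Shimura curves and the abc conjecture*, J. Number Theory 254 (2024), 214–335,
  doi:10.1016/j.jnt.2023.07.002 = arXiv:1705.09251: §4.11 (p. 16), §5.4 and Prop. 5.4 (p. 17).
  [PastenShimura2024]
* F. Diamond, J. Shurman, *A first course in modular forms*, GTM 228 (2005), Prop. 5.2.2,
  Prop. 5.8.5. [DiamondShurman2005]
-/

noncomputable section

open scoped MatrixGroups ModularForm

open CongruenceSubgroup UpperHalfPlane

namespace Literature.NumberTheory.EllipticCurves.ModularForms

/-! ### Prop. 5.4 in polynomial form (proved) -/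

section PropFiveFour

variable {N : ℕ} [NeZero N] {k : ℤ}

/-- Evaluation of the eigencharacter on an integer polynomial in the Hecke ring: for a ring map
`φ : 𝕋 → S` and `Q ∈ ℤ[x₁, …]`, `φ(Q(t₁, …)) = Q(φ(t₁), …)`. [folklore] -/
theorem ringHom_aeval_anemicHeckeRing {S : Type*} [CommRing S] (φ : anemicHeckeRing N k →+* S)
    {ι : Type*} (t : ι → anemicHeckeRing N k) (Q : MvPolynomial ι ℤ) :
    φ (MvPolynomial.aeval t Q) = MvPolynomial.aeval (fun i ↦ φ (t i)) Q :=
  MvPolynomial.comp_aeval_apply (f := t) φ.toIntAlgHom Q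

/-- **Pasten 2024, Prop. 5.4, first half (polynomial form).** Let `f ≠ 0` have integral
eigenvalues (system `χ₀ : 𝕋 → ℤ`) and let `g ≠ 0` be a simultaneous eigenvector (system
`χ = χ_g : 𝕋 → ℂ`). If an integer polynomial `Q ∈ ℤ[x₁, …, x_ℓ]` and primes `p₁, …, p_ℓ ∤ N`
satisfy `Q(χ(T_{p₁}), …, χ(T_{p_ℓ})) = 0`, then `η_{[χ₀]}([χ]) = heckeCongruenceModulus f 𝕀_{[χ]}`
divides the integer `Q(χ₀(T_{p₁}), …, χ₀(T_{p_ℓ}))` (`= Q(a_{p₁}(A), …, a_{p_ℓ}(A))`): the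
element `t = Q(T_{p₁}, …, T_{p_ℓ}) ∈ 𝕋` lies in `ker χ = 𝕀_{[χ]}` and `χ₀(t) = Q(χ₀(T_{pᵢ}))`
(`heckeCongruenceModulus_dvd_of_mem`). [cite: PastenShimura2024, Prop. 5.4 p. 17] -/
theorem heckeCongruenceModulus_dvd_aeval {f g : CuspForm (Gamma0 N) k}
    (hf : HasIntegralEigenvalues f) (hf0 : f ≠ 0) (hg : IsAnemicEigenvector g) (hg0 : g ≠ 0)
    {ℓ : ℕ} (Q : MvPolynomial (Fin ℓ) ℤ) (p : Fin ℓ → ℕ) (hp : ∀ i, (p i).Prime)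
    (hpN : ∀ i, ¬p i ∣ N)
    (hQ : MvPolynomial.aeval (fun i ↦ eigencharacter hg hg0
      (haveI : NeZero (p i) := ⟨(hp i).ne_zero⟩; anemicHeckeRing.T N k (p i) (hp i) (hpN i)))
        Q = 0) :
    (heckeCongruenceModulus f (eigenIdeal g) : ℤ) ∣
      MvPolynomial.aeval (fun i ↦ intEigencharacter hf hf0
        (haveI : NeZero (p i) := ⟨(hp i).ne_zero⟩; anemicHeckeRing.T N k (p i) (hp i) (hpN i)))
          Q := by
  set T : Fin ℓ → anemicHeckeRing N k := fun i ↦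
    (haveI : NeZero (p i) := ⟨(hp i).ne_zero⟩; anemicHeckeRing.T N k (p i) (hp i) (hpN i))
    with hT
  set t : anemicHeckeRing N k := MvPolynomial.aeval T Q with ht
  have hmem : t ∈ eigenIdeal g := by
    rw [eigenIdeal_eq_ker_eigencharacter hg hg0, RingHom.mem_ker, ht,
      ringHom_aeval_anemicHeckeRing]
    exact hQ
  have h := heckeCongruenceModulus_dvd_of_mem hf hf0 (P := eigenIdeal g) hmem
  rwa [ht, ringHom_aeval_anemicHeckeRing] at h

/-- Every element of `𝕋 = ℤ[T_p : p ∤ N]` is an integer polynomial in finitely many generators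
`T_{p₁}, …, T_{p_ℓ}`, `pᵢ ∤ N` prime (`Algebra.adjoin_eq_range`, `MvPolynomial.exists_fin_rename`).
[folklore] -/
theorem anemicHeckeRing.exists_eq_aeval (t : anemicHeckeRing N k) :
    ∃ (ℓ : ℕ) (Q : MvPolynomial (Fin ℓ) ℤ) (p : Fin ℓ → ℕ) (hp : ∀ i, (p i).Prime)
      (hpN : ∀ i, ¬p i ∣ N),
      t = MvPolynomial.aeval (fun i ↦
        (haveI : NeZero (p i) := ⟨(hp i).ne_zero⟩; anemicHeckeRing.T N k (p i) (hp i) (hpN i)))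
          Q := by
  classical
  -- `𝕋 = ℤ[T_p : p ∤ N]` is generated as a `ℤ`-algebra by its elements lying over the generators
  set S' : Set (anemicHeckeRing N k) :=
    ((↑) : anemicHeckeRing N k → Module.End ℂ (CuspForm (Gamma0 N) k)) ⁻¹'
      anemicHeckeGenerators N k with hS'
  have htop : Algebra.adjoin ℤ S' = ⊤ := by
    rw [hS']
    exact Algebra.adjoin_adjoin_coe_preimage (R := ℤ) (s := anemicHeckeGenerators N k)
  have ht : t ∈ (MvPolynomial.aeval (R := ℤ) ((↑) : S' → anemicHeckeRing N k)).range := by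
    rw [← Algebra.adjoin_eq_range, htop]
    exact Algebra.mem_top
  obtain ⟨Q₀, hQ₀⟩ := ht
  obtain ⟨ℓ, e, -, q, rfl⟩ := MvPolynomial.exists_fin_rename Q₀
  have hgen : ∀ i, ∃ (p : ℕ) (hp : p.Prime), ¬p ∣ N ∧
      (((e i : S') : anemicHeckeRing N k) : Module.End ℂ (CuspForm (Gamma0 N) k)) =
        (haveI : NeZero p := ⟨hp.ne_zero⟩; heckeT (Gamma0 N) k p) := fun i ↦ (e i).2
  choose p hp hpN heq using hgen
  refine ⟨ℓ, q, p, hp, hpN, ?_⟩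
  have hfun : (((↑) : S' → anemicHeckeRing N k) ∘ e) = fun i ↦
      (haveI : NeZero (p i) := ⟨(hp i).ne_zero⟩; anemicHeckeRing.T N k (p i) (hp i) (hpN i)) := by
    funext i
    apply Subtype.ext
    rw [Function.comp_apply, anemicHeckeRing.coe_T]
    exact heq i
  have hQ₀' : MvPolynomial.aeval ((↑) : S' → anemicHeckeRing N k) (MvPolynomial.rename e q) = t :=
    hQ₀
  rw [MvPolynomial.aeval_rename, hfun] at hQ₀'
  exact hQ₀'.symm

/-- **Pasten 2024, Prop. 5.4, second half (polynomial form).** With `f`, `χ₀`, `g`, `χ` as in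
`heckeCongruenceModulus_dvd_aeval`: if a natural number `m` divides `Q(χ₀(T_{p₁}), …, χ₀(T_{p_ℓ}))`
for every integer polynomial `Q ∈ ℤ[x₁, …, x_ℓ]` and all primes `p₁, …, p_ℓ ∤ N` with
`Q(χ(T_{p₁}), …, χ(T_{p_ℓ})) = 0`, then `m ∣ η_{[χ₀]}([χ])`: every `t ∈ 𝕀_{[χ]} = ker χ` is such a
polynomial in the generators (`anemicHeckeRing.exists_eq_aeval`), so `m ∣ χ₀(t)` for all
`t ∈ 𝕀_{[χ]}`, and `dvd_heckeCongruenceModulus_of_forall_dvd` applies. Hence `η` is the largest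
such `m` in the divisibility order (and numerically, `isGreatest_heckeCongruenceModulus`).
[cite: PastenShimura2024, Prop. 5.4 p. 17] -/
theorem dvd_heckeCongruenceModulus_of_forall_aeval {f g : CuspForm (Gamma0 N) k}
    (hf : HasIntegralEigenvalues f) (hf0 : f ≠ 0) (hg : IsAnemicEigenvector g) (hg0 : g ≠ 0)
    {m : ℕ}
    (hm : ∀ (ℓ : ℕ) (Q : MvPolynomial (Fin ℓ) ℤ) (p : Fin ℓ → ℕ) (hp : ∀ i, (p i).Prime)
      (hpN : ∀ i, ¬p i ∣ N),
      MvPolynomial.aeval (fun i ↦ eigencharacter hg hg0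
        (haveI : NeZero (p i) := ⟨(hp i).ne_zero⟩; anemicHeckeRing.T N k (p i) (hp i) (hpN i)))
          Q = 0 →
      (m : ℤ) ∣ MvPolynomial.aeval (fun i ↦ intEigencharacter hf hf0
        (haveI : NeZero (p i) := ⟨(hp i).ne_zero⟩; anemicHeckeRing.T N k (p i) (hp i) (hpN i)))
          Q) :
    m ∣ heckeCongruenceModulus f (eigenIdeal g) := by
  refine dvd_heckeCongruenceModulus_of_forall_dvd hf hf0 fun t ht ↦ ?_
  obtain ⟨ℓ, Q, p, hp, hpN, rfl⟩ := anemicHeckeRing.exists_eq_aeval t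
  rw [eigenIdeal_eq_ker_eigencharacter hg hg0, RingHom.mem_ker, ringHom_aeval_anemicHeckeRing]
    at ht
  rw [ringHom_aeval_anemicHeckeRing]
  exact hm ℓ Q p hp hpN ht

/-- **Pasten 2024, Prop. 5.4 (as printed: "the largest positive integer `m` with the following
property").** With `f`, `χ₀`, `g`, `χ` as above and `η = η_{[χ₀]}([χ]) ≠ 0` (i.e. `[χ] ≠ [χ₀]`:
the congruence module is finite), `η` is the greatest natural number `m` such that every integer
polynomial relation `Q(χ(T_{p₁}), …, χ(T_{p_ℓ})) = 0` (`pᵢ ∤ N` prime) forces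
`m ∣ Q(χ₀(T_{p₁}), …, χ₀(T_{p_ℓ}))`. [cite: PastenShimura2024, Prop. 5.4 p. 17] -/
theorem isGreatest_heckeCongruenceModulus {f g : CuspForm (Gamma0 N) k}
    (hf : HasIntegralEigenvalues f) (hf0 : f ≠ 0) (hg : IsAnemicEigenvector g) (hg0 : g ≠ 0)
    (hη : heckeCongruenceModulus f (eigenIdeal g) ≠ 0) :
    IsGreatest {m : ℕ | ∀ (ℓ : ℕ) (Q : MvPolynomial (Fin ℓ) ℤ) (p : Fin ℓ → ℕ)
      (hp : ∀ i, (p i).Prime) (hpN : ∀ i, ¬p i ∣ N),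
      MvPolynomial.aeval (fun i ↦ eigencharacter hg hg0
        (haveI : NeZero (p i) := ⟨(hp i).ne_zero⟩; anemicHeckeRing.T N k (p i) (hp i) (hpN i)))
          Q = 0 →
      (m : ℤ) ∣ MvPolynomial.aeval (fun i ↦ intEigencharacter hf hf0
        (haveI : NeZero (p i) := ⟨(hp i).ne_zero⟩; anemicHeckeRing.T N k (p i) (hp i) (hpN i)))
          Q}
      (heckeCongruenceModulus f (eigenIdeal g)) :=
  ⟨fun _ Q p hp hpN hQ ↦ heckeCongruenceModulus_dvd_aeval hf hf0 hg hg0 Q p hp hpN hQ,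
    fun _ hm ↦ Nat.le_of_dvd (Nat.pos_of_ne_zero hη)
      (dvd_heckeCongruenceModulus_of_forall_aeval hf hf0 hg hg0 hm)⟩

end PropFiveFour

/-! ### The eigen-ideal is a minimal prime; positivity of the congruence modulus -/

section Minimal

variable {N : ℕ} [NeZero N] {k : ℤ}

/-- An integer `n ∈ ℤ ⊆ 𝕋` annihilates a nonzero cusp form only if `n = 0` (`n` acts as the
scalar `n` on the complex vector space `S_k(Γ₀(N))`). [folklore] -/
theorem algebraMap_int_mem_eigenIdeal_iff {f : CuspForm (Gamma0 N) k} (hf0 : f ≠ 0) (n : ℤ) :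
    algebraMap ℤ (anemicHeckeRing N k) n ∈ eigenIdeal f ↔ n = 0 := by
  rw [mem_eigenIdeal]
  have h : ((algebraMap ℤ (anemicHeckeRing N k) n : anemicHeckeRing N k) :
      Module.End ℂ (CuspForm (Gamma0 N) k)) f = (n : ℂ) • f := by
    rw [Subalgebra.coe_algebraMap, Algebra.algebraMap_eq_smul_one, LinearMap.smul_apply,
      Module.End.one_apply, Int.cast_smul_eq_zsmul]
  rw [h, smul_eq_zero_iff_left hf0, Int.cast_eq_zero]

/-- **The eigen-ideal `𝕀_{[χ₀]} = ker χ₀` of a nonzero simultaneous eigenvector is a minimal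
prime of the Hecke ring `𝕋`** (Pasten 2024, §4.11: the kernels `𝕀_{[χ]}` of the classes of
systems of Hecke eigenvalues are the minimal primes of the reduced ring `𝕋 ⊆ End(S₂)`; here for
one class). Proof: `𝕀 = ker χ` is prime (`isPrime_eigenIdeal`); if `Q ⊆ 𝕀` is prime, then
`𝕋 ⧸ Q` is an integral domain, module-finite and hence integral over `ℤ`, and the image `𝕀̄` of
`𝕀` in it satisfies `𝕀̄ ∩ ℤ = 0` (an integer `n` lies in `𝕀 + Q = 𝕀` only if `n f = 0`, i.e.
`n = 0`); so `𝕀̄ = 0` (`Ideal.eq_bot_of_comap_eq_bot`), i.e. `𝕀 ⊆ Q`.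
[cite: PastenShimura2024, §4.11 p. 16] -/
theorem eigenIdeal_mem_minimalPrimes {f : CuspForm (Gamma0 N) k} (hf : IsAnemicEigenvector f)
    (hf0 : f ≠ 0) : eigenIdeal f ∈ minimalPrimes (anemicHeckeRing N k) := by
  rw [minimalPrimes_eq_minimals]
  refine ⟨isPrime_eigenIdeal hf hf0, fun Q hQ hQle ↦ ?_⟩
  haveI : Q.IsPrime := hQ
  haveI : Module.Finite ℤ (anemicHeckeRing N k ⧸ Q) :=
    Module.Finite.of_surjective (Ideal.Quotient.mkₐ ℤ Q).toLinearMap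
      (Ideal.Quotient.mkₐ_surjective ℤ Q)
  have hbot : ((eigenIdeal f).map (Ideal.Quotient.mk Q)).comap
      (algebraMap ℤ (anemicHeckeRing N k ⧸ Q)) = ⊥ := by
    refine eq_bot_iff.mpr fun n hn ↦ ?_
    rw [Ideal.mem_comap] at hn
    change Ideal.Quotient.mk Q (algebraMap ℤ (anemicHeckeRing N k) n) ∈ _ at hn
    rw [Ideal.mem_quotient_iff_mem_sup, sup_eq_left.mpr hQle,
      algebraMap_int_mem_eigenIdeal_iff hf0] at hn
    rw [hn]
    exact Ideal.zero_mem _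
  have hmap : (eigenIdeal f).map (Ideal.Quotient.mk Q) = ⊥ := Ideal.eq_bot_of_comap_eq_bot hbot
  intro x hx
  rw [← Ideal.Quotient.eq_zero_iff_mem, ← Ideal.mem_bot, ← hmap]
  exact Ideal.mem_map_of_mem _ hx

/-- A minimal prime of `𝕋` other than `𝕀_{[χ₀]}` is not contained in `𝕀_{[χ₀]}` (minimal primes
are pairwise incomparable). [folklore] -/
theorem not_le_eigenIdeal_of_mem_minimalPrimes {f : CuspForm (Gamma0 N) k}
    (hf : IsAnemicEigenvector f) (hf0 : f ≠ 0) {P : Ideal (anemicHeckeRing N k)}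
    (hP : P ∈ minimalPrimes (anemicHeckeRing N k)) (hne : P ≠ eigenIdeal f) :
    ¬P ≤ eigenIdeal f := fun hle ↦ by
  have hmin := eigenIdeal_mem_minimalPrimes hf hf0
  rw [minimalPrimes_eq_minimals] at hmin hP
  exact hne (le_antisymm hle (hmin.2 hP.1 hle))

/-- **The congruence modulus of a minimal prime `P ≠ 𝕀_{[χ₀]}` is a positive integer**
(Pasten 2024, §5.4: "This positive integer measures the congruences …"): for `f ≠ 0` with
`ℤ`-valued eigen-system `χ₀` and a minimal prime `P ≠ ker χ₀` of `𝕋`,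
`η = #(𝕋 ⧸ (ker χ₀ + P)) = [ℤ : χ₀(P)] ≠ 0`, because `P ⊄ ker χ₀` gives `χ₀(P) ≠ 0`.
[cite: PastenShimura2024, §5.4 p. 17] -/
theorem heckeCongruenceModulus_ne_zero {f : CuspForm (Gamma0 N) k}
    (hf : HasIntegralEigenvalues f) (hf0 : f ≠ 0) {P : Ideal (anemicHeckeRing N k)}
    (hP : P ∈ minimalPrimes (anemicHeckeRing N k)) (hne : P ≠ eigenIdeal f) :
    heckeCongruenceModulus f P ≠ 0 := by
  obtain ⟨t, htP, ht⟩ :=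
    Set.not_subset.mp (not_le_eigenIdeal_of_mem_minimalPrimes hf.isAnemicEigenvector hf0 hP hne)
  rw [heckeCongruenceModulus_eq_absNorm hf hf0, Ne, Ideal.absNorm_eq_zero_iff]
  intro hbot
  have hmem : intEigencharacter hf hf0 t ∈ P.map (intEigencharacter hf hf0) :=
    Ideal.mem_map_of_mem _ htP
  rw [hbot, Ideal.mem_bot] at hmem
  apply ht
  rw [SetLike.mem_coe, eigenIdeal_eq_ker_intEigencharacter hf hf0, RingHom.mem_ker]
  exact hmem

/-- Numerically: `0 < η_{[χ₀]}(P)` for a minimal prime `P ≠ 𝕀_{[χ₀]}`. [folklore] -/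
theorem heckeCongruenceModulus_pos {f : CuspForm (Gamma0 N) k}
    (hf : HasIntegralEigenvalues f) (hf0 : f ≠ 0) {P : Ideal (anemicHeckeRing N k)}
    (hP : P ∈ minimalPrimes (anemicHeckeRing N k)) (hne : P ≠ eigenIdeal f) :
    0 < heckeCongruenceModulus f P :=
  Nat.pos_of_ne_zero (heckeCongruenceModulus_ne_zero hf hf0 hP hne)

end Minimal

/-! ### The newform of an elliptic curve: `f ≠ 0`, integral eigenvalues -/

namespace ModularParametrizationData

variable {W : WeierstrassCurve ℚ} {N : ℕ} [NeZero N]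

/-- The newform of a modular parametrisation datum is nonzero (`a₁(f) = 1`). [folklore] -/
theorem f_ne_zero (D : ModularParametrizationData W N) : D.f ≠ 0 := by
  intro h
  have h1 : (qExpansion 1 ⇑D.f).coeff 1 = 1 := D.isNewformOf.1.2.2
  rw [h, CuspForm.coe_zero, UpperHalfPlane.qExpansion_zero, map_zero] at h1
  exact zero_ne_one h1

/-- **The newform of an elliptic curve has integral Hecke eigenvalues**: `T_p f = a_p(W) f` with
`a_p(W) ∈ ℤ` for every prime `p ∤ N` (indeed for every prime): `f` is an eigenvector of `T_p`
(`IsNewform0`), the eigenvalue is `a_p(f)` by comparing the coefficients of `q¹`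
(`a₁(T_p f) = a_p(f)`, Diamond–Shurman Prop. 5.2.2(a), the tree's `qExpansion_coeff_heckeT_holds`;
`a₁(f) = 1`), and `a_p(f) = a_p(W) ∈ ℤ` (`IsNewformOf`). So Pasten's `χ₀` is `ℤ`-valued (§5.1).
[cite: DiamondShurman2005, Prop. 5.2.2(a) and Prop. 5.8.5] -/
theorem hasIntegralEigenvalues_f (D : ModularParametrizationData W N) :
    HasIntegralEigenvalues D.f := by
  intro p hp _
  haveI : NeZero p := ⟨hp.ne_zero⟩
  obtain ⟨hnew, hcoeff⟩ := D.isNewformOf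
  have heig := heckeT_eq_heckeEigenvalue_smul D.f p (hnew.2.1 p hp)
  have h1 := qExpansion_coeff_heckeT_holds N 2 D.f p hp 1
  have hcoe : ⇑(heckeT (Gamma0 N) 2 p D.f) = heckeEigenvalue D.f p • ⇑D.f := by
    rw [heig]; rfl
  have hnorm : (qExpansion 1 ⇑D.f).coeff 1 = 1 := hnew.2.2
  rw [hcoe, ModularForm.qExpansion_smul one_pos (one_mem_strictPeriods_gamma0 N) _ D.f, map_smul,
    smul_eq_mul, hnorm, mul_one, mul_one, if_neg (Nat.Prime.not_dvd_one hp), mul_zero,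
    ite_self, add_zero] at h1
  refine ⟨W.LFunction p, ?_⟩
  rw [heig, h1]
  exact congrArg (· • D.f) (hcoeff p)

/-- The eigen-ideal `𝕀_{[χ₀]}` of the newform of an elliptic curve is a minimal prime of `𝕋`.
[folklore] -/
theorem eigenIdeal_mem_minimalPrimes (D : ModularParametrizationData W N) :
    eigenIdeal D.f ∈ minimalPrimes (anemicHeckeRing N 2) :=
  ModularForms.eigenIdeal_mem_minimalPrimes D.hasIntegralEigenvalues_f.isAnemicEigenvector
    D.f_ne_zero

/-- Every congruence modulus `η_{[χ₀]}(P)`, `P ≠ 𝕀_{[χ₀]}` a minimal prime, of the newform of an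
elliptic curve is a positive integer (Pasten 2024, §5.4). [cite: PastenShimura2024, §5.4 p. 17] -/
theorem heckeCongruenceModulus_ne_zero (D : ModularParametrizationData W N)
    {P : Ideal (anemicHeckeRing N 2)} (hP : P ∈ minimalPrimes (anemicHeckeRing N 2))
    (hne : P ≠ eigenIdeal D.f) : heckeCongruenceModulus D.f P ≠ 0 :=
  ModularForms.heckeCongruenceModulus_ne_zero D.hasIntegralEigenvalues_f D.f_ne_zero hP hne

/-- The product `∏_{[χ] ≠ [χ₀]} η_{[χ₀]}([χ])` of Pasten's Thm. 5.5 — over the minimal primes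
`P ≠ 𝕀_{[χ₀]}` of `𝕋` — is a positive integer. [cite: PastenShimura2024, §5.4 p. 17] -/
theorem prod_heckeCongruenceModulus_pos (D : ModularParametrizationData W N) :
    0 < ∏ P ∈ ((finite_minimalPrimes_anemicHeckeRing N 2).toFinset.erase (eigenIdeal D.f)),
      heckeCongruenceModulus D.f P := by
  refine Finset.prod_pos fun P hP ↦ Nat.pos_of_ne_zero (D.heckeCongruenceModulus_ne_zero ?_ ?_)
  · exact (finite_minimalPrimes_anemicHeckeRing N 2).mem_toFinset.mp (Finset.mem_of_mem_erase hP)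
  · exact Finset.ne_of_mem_erase hP

end ModularParametrizationData

end Literature.NumberTheory.EllipticCurves.ModularForms

end
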